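import Literature.NumberTheory.Automorphic.IrreducibleClassesConstituents
import HarnessLib

/-!
# Central characters of constituents: central scalars descend to every irreducible subquotient

Generic representation theory around the tree's ★ `IrrClass.IsConstituentOf c ρ` («`c ∈ Irr(G)` is the class of an irreducible smooth
SUBQUOTIENT `N₁ ⁄ N₂` of `ρ`», `Automorphic/UnitaryGroupBorelInduction` §5) and ★ `IrrClass.HasCentralCharacter` ∕ ★
`Representation.HasCentralCharacter` («every `z ∈ Z(G)` acts as the scalar `ω z`», `Automorphic/SmoothRepresentation`, `Automorphic/IrreducibleClasses`):
**if the centre of `G` acts on `ρ` through a character `ω`, then every constituent of `ρ` has central character `ω`** — scalars pass to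
`G`-stable subspaces (§1 `HasCentralCharacter.subrepresentation`), to quotients (§1 `HasCentralCharacter.quotient`), hence to subquotients, and along
equivalences (★ `HasCentralCharacter.of_equiv`), so to the class of any irreducible subquotient (§2 `IrrClass.IsConstituentOf.hasCentralCharacter`);
a pointwise introduction rule (§1 `hasCentralCharacter_of_forall_apply`), the restriction form along a group morphism `φ : H →* G` whose source centre
acts by scalars (§2 `IrrClass.IsConstituentOf.hasCentralCharacter_comp`), and the transport of central characters along ★ `IrrClass.comap e` for an
isomorphism of topological groups `e : G′ ≃ₜ* G` (§3 `IrrClass.HasCentralCharacter.comap` ∕ `.of_comap`, centre matched by Mathlib `Subgroup.centerCongr`).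
This is the «central character of a constituent of `i_G(χ)` ∕ of a local constituent of an automorphic `π`» step of [Rogawski1990, §12.2 p. 173]
(«the constituents of `i_G(χ)` … have central character `χ|_Z`») and [BushnellHenniart2006, §2.6–2.7]; no packets, no admissibility.

References: [BushnellHenniart2006] C. Bushnell, G. Henniart, *The local Langlands conjecture for GL(2)* (2006), §1.1, §2.6–2.7;
[BernsteinZelevinsky1976] I. N. Bernstein, A. V. Zelevinsky, Russian Math. Surveys 31 (1976), §2.10; [Rogawski1990] J. Rogawski, *Automorphic
representations of unitary groups in three variables* (1990), §12.2 p. 173.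
-/

set_option autoImplicit false

/-! ## §1 Representation level: subrepresentations, quotients, pointwise introduction -/

namespace Representation

variable {k G V : Type*} [CommRing k] [Group G] [AddCommGroup V] [Module k V] {ρ : Representation k G V}
  {ω : Subgroup.center G →* kˣ}

/-- **Pointwise introduction rule**: if every central `z` acts on every vector by the scalar `ω z`, then `ρ` has central character `ω`.
[cite: BushnellHenniart2006, §2.6] -/
theorem hasCentralCharacter_of_forall_apply (h : ∀ (z : Subgroup.center G) (v : V), ρ (z : G) v = ((ω z : kˣ) : k) • v) :
    ρ.HasCentralCharacter ω :=
  fun z => LinearMap.ext fun v => by rw [h z v]; rfl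

/-- **Central scalars pass to `G`-stable subspaces**: if `ρ` has central character `ω`, so does every subrepresentation `N ≤ ρ`
(Mathlib `Subrepresentation.toRepresentation`). [cite: BushnellHenniart2006, §2.6] -/
theorem HasCentralCharacter.subrepresentation (h : ρ.HasCentralCharacter ω) (N : Subrepresentation ρ) :
    N.toRepresentation.HasCentralCharacter ω :=
  hasCentralCharacter_of_forall_apply fun z v => Subtype.ext (by
    change ρ (z : G) (v : V) = ((((ω z : kˣ) : k) • v : N.toSubmodule) : V)
    rw [h.apply, Submodule.coe_smul])

/-- **Central scalars pass to quotients**: if `ρ` has central character `ω`, so does `ρ ⁄ W` for every `G`-stable `W`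
(Mathlib `Representation.quotient`). [cite: BushnellHenniart2006, §2.6] -/
theorem HasCentralCharacter.quotient (h : ρ.HasCentralCharacter ω) (W : Submodule k V) (hW : ∀ g, W ≤ W.comap (ρ g)) :
    (ρ.quotient W hW).HasCentralCharacter ω :=
  fun z => Submodule.linearMap_qext _ (LinearMap.ext fun v => by
    rw [LinearMap.comp_apply, Submodule.mkQ_apply, Representation.quotient_apply, Submodule.mapQ_apply, h.apply,
      Submodule.Quotient.mk_smul]
    rfl)

end Representation

/-! ## §2 Class level: every constituent inherits the central character -/

namespace Literature.NumberTheory.Automorphic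

universe u

namespace IrrClass

variable {G : Type u} [Group G] [TopologicalSpace G]

/-- **Every constituent of a representation with central character `ω` has central character `ω`**: a constituent class `c` of `ρ` is
the class of an irreducible smooth `r ≃ N₁ ⁄ N₂` (`G`-stable `N₂ ≤ N₁ ≤ ρ`); the centre acts by `ω` on `N₁` (§1 `subrepresentation`), on
`N₁ ⁄ N₂` (§1 `quotient`), hence on `r` (★ `HasCentralCharacter.of_equiv` along the inverse equivalence).  In print: the constituents of
`i_G(χ)` have the central character of `i_G(χ)`. [cite: Rogawski1990, §12.2 p. 173] [cite: BushnellHenniart2006, §2.6–2.7] -/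
theorem IsConstituentOf.hasCentralCharacter {V : Type*} [AddCommGroup V] [Module ℂ V] {ρ : Representation ℂ G V}
    {ω : Subgroup.center G →* ℂˣ} (hρ : ρ.HasCentralCharacter ω) {c : IrrClass G} (hc : c.IsConstituentOf ρ) :
    c.HasCentralCharacter ω := by
  obtain ⟨r, rfl, N₁, N₂, _, ⟨e⟩⟩ := hc
  rw [hasCentralCharacter_mk]
  exact ((hρ.subrepresentation N₁).quotient _ _).of_equiv e.symm

/-- **Pointwise form**: if every central `z` acts on `ρ` by the scalar `ω z`, every constituent of `ρ` has central character `ω`.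
[cite: Rogawski1990, §12.2 p. 173] [cite: BushnellHenniart2006, §2.6] -/
theorem IsConstituentOf.hasCentralCharacter_of_forall_apply {V : Type*} [AddCommGroup V] [Module ℂ V] {ρ : Representation ℂ G V}
    {ω : Subgroup.center G →* ℂˣ} (hρ : ∀ (z : Subgroup.center G) (v : V), ρ (z : G) v = ((ω z : ℂˣ) : ℂ) • v)
    {c : IrrClass G} (hc : c.IsConstituentOf ρ) : c.HasCentralCharacter ω :=
  hc.hasCentralCharacter (Representation.hasCentralCharacter_of_forall_apply hρ)

omit [TopologicalSpace G] in
/-- **Restriction form** (the shape of «a local constituent of `π|_{G(F_v)}` has central character `ψ_π|_{Z(G(F_v))}`»): for a group morphism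
`φ : H →* G` and a representation `ρ` of `G` on which `φ(z)` acts by the scalar `ω z` for every central `z ∈ Z(H)`, every constituent of the
restriction `ρ ∘ φ` has central character `ω`. [cite: Rogawski1990, §12.2 p. 173; §13.3 p. 201] [cite: BushnellHenniart2006, §2.6] -/
theorem IsConstituentOf.hasCentralCharacter_comp {H : Type u} [Group H] [TopologicalSpace H] {V : Type*} [AddCommGroup V] [Module ℂ V]
    {ρ : Representation ℂ G V} (φ : H →* G) {ω : Subgroup.center H →* ℂˣ}
    (hρ : ∀ (z : Subgroup.center H) (v : V), ρ (φ (z : H)) v = ((ω z : ℂˣ) : ℂ) • v)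
    {c : IrrClass H} (hc : c.IsConstituentOf (ρ.comp φ)) : c.HasCentralCharacter ω :=
  hc.hasCentralCharacter_of_forall_apply fun z v => by rw [MonoidHom.comp_apply]; exact hρ z v

/-! ## §3 Transport along `IrrClass.comap e` for an isomorphism of topological groups `e : G′ ≃ₜ* G` -/

variable {G' : Type u} [Group G'] [TopologicalSpace G']

/-- **`comap` transports central characters**: if `c ∈ Irr(G)` has central character `ω`, then its pull-back `c ∘ e ∈ Irr(G′)` along
`e : G′ ≃ₜ* G` has central character `ω ∘ e|_{Z}` (Mathlib `Subgroup.centerCongr` matches the centres). [cite: BushnellHenniart2006, §1.1; §2.6] -/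
theorem HasCentralCharacter.comap (e : G' ≃ₜ* G) {c : IrrClass G} {ω : Subgroup.center G →* ℂˣ} (h : c.HasCentralCharacter ω) :
    (IrrClass.comap e c).HasCentralCharacter (ω.comp (Subgroup.centerCongr e.toMulEquiv).toMonoidHom) := by
  obtain ⟨r, rfl⟩ := IrrClass.mk_surjective c
  rw [comap_mk, hasCentralCharacter_mk]
  rw [hasCentralCharacter_mk] at h
  intro z
  rw [SmoothIrrep.comap_ρ_apply, MonoidHom.comp_apply, MulEquiv.coe_toMonoidHom]
  have hz := h (Subgroup.centerCongr e.toMulEquiv z)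
  rw [Subgroup.centerCongr_apply_coe] at hz
  exact hz

/-- **Converse transport**: if the pull-back `c ∘ e` has central character `ω′` on `Z(G′)`, then `c` has central character
`ω′ ∘ e⁻¹|_{Z}` on `Z(G)`. [cite: BushnellHenniart2006, §1.1; §2.6] -/
theorem HasCentralCharacter.of_comap (e : G' ≃ₜ* G) {c : IrrClass G} {ω' : Subgroup.center G' →* ℂˣ}
    (h : (IrrClass.comap e c).HasCentralCharacter ω') :
    c.HasCentralCharacter (ω'.comp (Subgroup.centerCongr e.toMulEquiv).symm.toMonoidHom) := by
  obtain ⟨r, rfl⟩ := IrrClass.mk_surjective c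
  rw [comap_mk, hasCentralCharacter_mk] at h
  rw [hasCentralCharacter_mk]
  intro z
  rw [MonoidHom.comp_apply, MulEquiv.coe_toMonoidHom]
  have hz := h ((Subgroup.centerCongr e.toMulEquiv).symm z)
  rw [SmoothIrrep.comap_ρ_apply, Subgroup.centerCongr_symm_apply_coe] at hz
  have he : e (e.toMulEquiv.symm (z : G)) = (z : G) := e.toMulEquiv.apply_symm_apply _
  rw [he] at hz
  exact hz

end IrrClass

end Literature.NumberTheory.Automorphic
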